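import Mathlib
import Literature.Geometry.DiscreteGeometry.KissingPatterns
import HarnessLib

/-!
# The FCC/HCP dichotomy of twelve-point shells is exclusive: no shell is `δ`-close to both the
# cuboctahedron and the twisted cuboctahedron (`δ ≤ 1/10`)

Topic `Literature/Geometry/DiscreteGeometry`; companion of `KissingPatterns.lean` (`fccKissingPattern`
= `Cub`, `hcpKissingPattern` = `TCub`, `EtaMatched`, `ShellCloseTo`). The routes TwoCentreKissing /
SoftAnnulusKernel / GappedShellCensus phrase the local fcc/hcp alternative of a recentred shell `T`
as `ShellCloseTo δ T fccKissingPattern ∨ ShellCloseTo δ T hcpKissingPattern` (with `δ = 1/10` in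
`RobustTangencyBound`); Flatley–Theil state that the two cases EXCLUDE each other — "Proposition
3.3.2 implies that `X_Cub` and `X_TCub` form a partition of `X_reg`, i.e. `X_reg = X_Cub ∪ X_TCub`
and `X_Cub ∩ X_TCub = ∅`" [cite: FlatleyTheil2015, display after Definition 3.6, p. 10] — and
Hales describes the two patterns as different rigid arrangements ("the FCC pattern is a
cuboctahedron … In the HCP pattern, there is a uniquely determined plane of reflectional symmetry")
[cite: HalesDSP2012, §1.3, Fig. 1.11].

## Main statement

* `not_shellCloseTo_fcc_and_hcp (hδ : δ ≤ 1/10) (T) :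
  ¬ (ShellCloseTo δ T fccKissingPattern ∧ ShellCloseTo δ T hcpKissingPattern)` — EFFECTIVE and
  unconditional.

Mechanism (combinatorial, no optimisation over rotations): two matchings give a bijection
`g : B(TCub) ≃ A(Cub)` moving every point by `≤ 2δ`, hence changing mutual distances by `≤ 4δ`;
distinct points of `Cub` are at distance `1` or `≥ √2 > 1 + 4δ`
(`dist_eq_one_or_sqrt_two_le_of_mem_fccKissingPattern`, integer model), so `g` maps unit pairs
to unit pairs; but the two contact graphs are not isomorphic, indeed not even "injectively
homomorphic" in this direction: in `Cub` every unit edge has at most one common unit neighbour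
(`fccKissingPattern_commonNeighbour_unique`, kernel decision on `fccInt`), whereas `TCub` has the
unit edge `(0,3,−3)/√18, (3,0,−3)/√18` with the two common unit neighbours `(3,3,0)/√18`,
`(−1,−1,−4)/√18` (`hcpKissingPattern_two_commonNeighbours`). The constant: `1 + 4·(1/10) < √2`.
No definition, no named fact (D-0026).
-/

noncomputable section

namespace Literature.Geometry.DiscreteGeometry

open Finset

/-! ### Distances in the integer models -/

/-- Distance in a scaled integer pattern. [folklore] -/
private theorem dist_smul_intVec {N : ℕ} (hN : N ≠ 0) (v w : Fin 3 → ℤ) :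
    dist ((Real.sqrt N)⁻¹ • intVec v) ((Real.sqrt N)⁻¹ • intVec w) =
      (Real.sqrt N)⁻¹ * Real.sqrt (sqNormInt (v - w) : ℝ) := by
  have hpos : (0 : ℝ) < Real.sqrt N := by positivity
  rw [dist_eq_norm, ← smul_sub, intVec_sub, norm_smul, norm_inv, Real.norm_of_nonneg hpos.le,
    norm_intVec]

/-- Unit distance in a scaled integer pattern is an integer condition. [folklore] -/
private theorem dist_smul_intVec_eq_one_iff {N : ℕ} (hN : N ≠ 0) (v w : Fin 3 → ℤ) :
    dist ((Real.sqrt N)⁻¹ • intVec v) ((Real.sqrt N)⁻¹ • intVec w) = 1 ↔ sqNormInt (v - w) = N := by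
  have hpos : (0 : ℝ) < Real.sqrt N := by positivity
  rw [dist_smul_intVec hN, inv_mul_eq_one₀ hpos.ne']
  have h0 : (0 : ℝ) ≤ (sqNormInt (v - w) : ℝ) := by unfold sqNormInt; positivity
  rw [Real.sqrt_inj (Nat.cast_nonneg _) h0]
  constructor
  · intro h; exact_mod_cast h.symm
  · intro h; rw [h]; push_cast; rfl

/-- In `fccInt`, distinct vectors differ by squared norm `2` (contact) or `≥ 4`. [folklore] -/
private theorem fccInt_gap : ∀ v ∈ fccInt, ∀ w ∈ fccInt, v ≠ w →
    sqNormInt (v - w) = ((2 : ℕ) : ℤ) ∨ 4 ≤ sqNormInt (v - w) := by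
  decide

/-- In the cuboctahedron every unit edge has at most one common unit neighbour (integer model,
kernel decision). [folklore] -/
private theorem fccInt_commonNeighbour_unique :
    ∀ v ∈ fccInt, ∀ w ∈ fccInt, sqNormInt (v - w) = ((2 : ℕ) : ℤ) →
      ∀ c ∈ fccInt, ∀ d ∈ fccInt,
      sqNormInt (c - v) = ((2 : ℕ) : ℤ) → sqNormInt (c - w) = ((2 : ℕ) : ℤ) →
      sqNormInt (d - v) = ((2 : ℕ) : ℤ) → sqNormInt (d - w) = ((2 : ℕ) : ℤ) → c = d := by
  decide

/-! ### The two patterns -/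

/-- **Distinct points of `Cub` are at distance `1` or `≥ √2`** (the distances occurring are
`1, √2, √3, 2`). [cite: HalesDSP2012, §1.3, Fig. 1.11 (the FCC pattern is a cuboctahedron)] -/
theorem dist_eq_one_or_sqrt_two_le_of_mem_fccKissingPattern {p q : EuclideanSpace ℝ (Fin 3)}
    (hp : p ∈ fccKissingPattern) (hq : q ∈ fccKissingPattern) (hpq : p ≠ q) :
    dist p q = 1 ∨ Real.sqrt 2 ≤ dist p q := by
  obtain ⟨v, hv, rfl⟩ := mem_image.1 hp
  obtain ⟨w, hw, rfl⟩ := mem_image.1 hq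
  have hvw : v ≠ w := fun h => hpq (by rw [h])
  rcases fccInt_gap v hv w hw hvw with h | h
  · exact Or.inl ((dist_smul_intVec_eq_one_iff two_ne_zero v w).2 h)
  · right
    rw [dist_smul_intVec two_ne_zero]
    have h4 : (4 : ℝ) ≤ (sqNormInt (v - w) : ℝ) := by exact_mod_cast h
    have hs : (2 : ℝ) ≤ Real.sqrt (sqNormInt (v - w) : ℝ) := by
      rw [show (2 : ℝ) = Real.sqrt (2 ^ 2) by rw [Real.sqrt_sq (by norm_num)]]
      exact Real.sqrt_le_sqrt (by linarith)
    have h2 : (0 : ℝ) < Real.sqrt 2 := by positivity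
    have h22 : Real.sqrt 2 * Real.sqrt 2 = 2 := Real.mul_self_sqrt (by norm_num)
    rw [show Real.sqrt ((2 : ℕ) : ℝ) = Real.sqrt 2 by norm_num]
    calc Real.sqrt 2 = (Real.sqrt 2)⁻¹ * 2 := by
          rw [eq_inv_mul_iff_mul_eq₀ h2.ne', h22]
      _ ≤ (Real.sqrt 2)⁻¹ * Real.sqrt (sqNormInt (v - w) : ℝ) :=
          mul_le_mul_of_nonneg_left hs (inv_nonneg.2 h2.le)

/-- **In `Cub` two points at distance `1` have at most one common neighbour at distance `1`**
(every edge of the cuboctahedron lies in exactly one triangle).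
[cite: HalesDSP2012, §1.3, Fig. 1.11] -/
theorem fccKissingPattern_commonNeighbour_unique {a b c d : EuclideanSpace ℝ (Fin 3)}
    (ha : a ∈ fccKissingPattern) (hb : b ∈ fccKissingPattern) (hc : c ∈ fccKissingPattern)
    (hd : d ∈ fccKissingPattern) (hab : dist a b = 1) (hca : dist c a = 1) (hcb : dist c b = 1)
    (hda : dist d a = 1) (hdb : dist d b = 1) : c = d := by
  obtain ⟨v, hv, rfl⟩ := mem_image.1 ha
  obtain ⟨w, hw, rfl⟩ := mem_image.1 hb
  obtain ⟨p, hp, rfl⟩ := mem_image.1 hc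
  obtain ⟨q, hq, rfl⟩ := mem_image.1 hd
  rw [dist_smul_intVec_eq_one_iff two_ne_zero] at hab hca hcb hda hdb
  rw [fccInt_commonNeighbour_unique v hv w hw hab p hp q hq hca hcb hda hdb]

/-- **In `TCub` some unit edge has two common unit neighbours:** the edge
`(0,3,−3)/√18, (3,0,−3)/√18` and the points `(3,3,0)/√18`, `(−1,−1,−4)/√18` (an edge of the
hexagonal mid-layer lying in a triangle above and a triangle below). [cite: HalesDSP2012, §1.3,
Fig. 1.11 (the HCP pattern: one triangular cap reflected in the hexagonal mid-plane)] -/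
theorem hcpKissingPattern_two_commonNeighbours :
    ∃ a ∈ hcpKissingPattern, ∃ b ∈ hcpKissingPattern, ∃ c ∈ hcpKissingPattern,
      ∃ d ∈ hcpKissingPattern,
      dist a b = 1 ∧ dist c a = 1 ∧ dist c b = 1 ∧ dist d a = 1 ∧ dist d b = 1 ∧ c ≠ d := by
  have h18 : (18 : ℕ) ≠ 0 := by norm_num
  refine ⟨_, mem_image_of_mem _ (show ![0, 3, -3] ∈ hcpInt by decide),
    _, mem_image_of_mem _ (show ![3, 0, -3] ∈ hcpInt by decide),
    _, mem_image_of_mem _ (show ![3, 3, 0] ∈ hcpInt by decide),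
    _, mem_image_of_mem _ (show ![-1, -1, -4] ∈ hcpInt by decide),
    (dist_smul_intVec_eq_one_iff h18 _ _).2 (by decide),
    (dist_smul_intVec_eq_one_iff h18 _ _).2 (by decide),
    (dist_smul_intVec_eq_one_iff h18 _ _).2 (by decide),
    (dist_smul_intVec_eq_one_iff h18 _ _).2 (by decide),
    (dist_smul_intVec_eq_one_iff h18 _ _).2 (by decide), fun h => ?_⟩
  have := scaledPattern_map_injective h18 h
  exact absurd this (by decide)

/-! ### Exclusivity -/

/-- `Cub`'s distance gap, transported to an isometric image. [folklore] -/
private theorem dist_eq_one_or_sqrt_two_le_of_mem_fccKissingPattern_image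
    (A : EuclideanSpace ℝ (Fin 3) →ₗᵢ[ℝ] EuclideanSpace ℝ (Fin 3))
    {p q : EuclideanSpace ℝ (Fin 3)} (hp : p ∈ fccKissingPattern.image A)
    (hq : q ∈ fccKissingPattern.image A) (hpq : p ≠ q) :
    dist p q = 1 ∨ Real.sqrt 2 ≤ dist p q := by
  obtain ⟨p₀, hp₀, rfl⟩ := mem_image.1 hp
  obtain ⟨q₀, hq₀, rfl⟩ := mem_image.1 hq
  rw [A.isometry.dist_eq]
  exact dist_eq_one_or_sqrt_two_le_of_mem_fccKissingPattern hp₀ hq₀ fun h => hpq (by rw [h])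

/-- `Cub`'s common-neighbour uniqueness, transported to an isometric image. [folklore] -/
private theorem fccKissingPattern_commonNeighbour_unique_image
    (A : EuclideanSpace ℝ (Fin 3) →ₗᵢ[ℝ] EuclideanSpace ℝ (Fin 3))
    {a b c d : EuclideanSpace ℝ (Fin 3)} (ha : a ∈ fccKissingPattern.image A)
    (hb : b ∈ fccKissingPattern.image A) (hc : c ∈ fccKissingPattern.image A)
    (hd : d ∈ fccKissingPattern.image A) (hab : dist a b = 1) (hca : dist c a = 1)
    (hcb : dist c b = 1) (hda : dist d a = 1) (hdb : dist d b = 1) : c = d := by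
  obtain ⟨a₀, ha₀, rfl⟩ := mem_image.1 ha
  obtain ⟨b₀, hb₀, rfl⟩ := mem_image.1 hb
  obtain ⟨c₀, hc₀, rfl⟩ := mem_image.1 hc
  obtain ⟨d₀, hd₀, rfl⟩ := mem_image.1 hd
  rw [A.isometry.dist_eq] at hab hca hcb hda hdb
  rw [fccKissingPattern_commonNeighbour_unique ha₀ hb₀ hc₀ hd₀ hab hca hcb hda hdb]

/-- `1 + 4 δ < √2` for `δ ≤ 1/10`. [folklore] -/
private theorem one_add_four_mul_lt_sqrt_two {δ : ℝ} (hδ : δ ≤ 1 / 10) :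
    1 + 4 * δ < Real.sqrt 2 := by
  have h : (7 / 5 : ℝ) < Real.sqrt 2 := by
    rw [show (7 / 5 : ℝ) = Real.sqrt ((7 / 5) ^ 2) by rw [Real.sqrt_sq (by norm_num)]]
    exact Real.sqrt_lt_sqrt (by norm_num) (by norm_num)
  linarith

/-- **No finite `T ⊂ ℝ³` is `δ`-close (`δ ≤ 1/10`) to both the FCC and the HCP kissing pattern:**
the alternative `ShellCloseTo δ T fccKissingPattern ∨ ShellCloseTo δ T hcpKissingPattern` of the
routes is a genuine dichotomy. Effective and unconditional; Flatley–Theil's qualitative form is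
"`X_Cub ∩ X_TCub = ∅`". [cite: FlatleyTheil2015, display after Definition 3.6, p. 10]
[cite: HalesDSP2012, §1.3, Fig. 1.11] -/
theorem not_shellCloseTo_fcc_and_hcp {δ : ℝ} (hδ : δ ≤ 1 / 10)
    (T : Finset (EuclideanSpace ℝ (Fin 3))) :
    ¬ (ShellCloseTo δ T fccKissingPattern ∧ ShellCloseTo δ T hcpKissingPattern) := by
  rintro ⟨⟨A, e₁, he₁⟩, ⟨B, e₂, he₂⟩⟩
  -- the composite matching `B(TCub) → T → A(Cub)` moves points by at most `2δ`
  let g : ↥(hcpKissingPattern.image B) ≃ ↥(fccKissingPattern.image A) := e₂.symm.trans e₁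
  have hg : ∀ x : ↥(hcpKissingPattern.image B),
      dist (x : EuclideanSpace ℝ (Fin 3)) (g x : EuclideanSpace ℝ (Fin 3)) ≤ 2 * δ := by
    intro x
    have h1 := he₂ (e₂.symm x)
    have h2 := he₁ (e₂.symm x)
    rw [Equiv.apply_symm_apply] at h1
    calc dist (x : EuclideanSpace ℝ (Fin 3)) (g x : EuclideanSpace ℝ (Fin 3))
        ≤ dist (x : EuclideanSpace ℝ (Fin 3)) (e₂.symm x : EuclideanSpace ℝ (Fin 3)) +
          dist (e₂.symm x : EuclideanSpace ℝ (Fin 3)) (g x : EuclideanSpace ℝ (Fin 3)) :=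
          dist_triangle _ _ _
      _ ≤ δ + δ := by rw [dist_comm]; exact add_le_add h1 h2
      _ = 2 * δ := by ring
  -- hence unit pairs go to unit pairs
  have hlt := one_add_four_mul_lt_sqrt_two hδ
  have hadj : ∀ x x' : ↥(hcpKissingPattern.image B),
      dist (x : EuclideanSpace ℝ (Fin 3)) x' = 1 →
      dist (g x : EuclideanSpace ℝ (Fin 3)) (g x') = 1 := by
    intro x x' hxx'
    have hne : (g x : EuclideanSpace ℝ (Fin 3)) ≠ g x' := by
      intro h
      have : x = x' := g.injective (Subtype.ext h)
      rw [this, dist_self] at hxx'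
      exact zero_ne_one hxx'
    rcases dist_eq_one_or_sqrt_two_le_of_mem_fccKissingPattern_image A (g x).2 (g x').2 hne
      with h | h
    · exact h
    · exfalso
      have h4 := dist_triangle4 (g x : EuclideanSpace ℝ (Fin 3)) x x' (g x')
      have hx := hg x
      have hx' := hg x'
      rw [dist_comm] at hx
      linarith
  -- the witnesses of `TCub`, transported to `B(TCub)`
  obtain ⟨a, ha, b, hb, c, hc, d, hd, hab, hca, hcb, hda, hdb, hcd⟩ :=
    hcpKissingPattern_two_commonNeighbours
  let a' : ↥(hcpKissingPattern.image B) := ⟨B a, mem_image_of_mem _ ha⟩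
  let b' : ↥(hcpKissingPattern.image B) := ⟨B b, mem_image_of_mem _ hb⟩
  let c' : ↥(hcpKissingPattern.image B) := ⟨B c, mem_image_of_mem _ hc⟩
  let d' : ↥(hcpKissingPattern.image B) := ⟨B d, mem_image_of_mem _ hd⟩
  have hB : ∀ p q : EuclideanSpace ℝ (Fin 3), dist (B p) (B q) = dist p q :=
    fun p q => B.isometry.dist_eq p q
  have key := fccKissingPattern_commonNeighbour_unique_image A (g a').2 (g b').2 (g c').2
    (g d').2 (hadj a' b' (by simpa [a', b', hB] using hab))
    (hadj c' a' (by simpa [a', c', hB] using hca)) (hadj c' b' (by simpa [b', c', hB] using hcb))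
    (hadj d' a' (by simpa [a', d', hB] using hda)) (hadj d' b' (by simpa [b', d', hB] using hdb))
  have hcd' : c' = d' := g.injective (Subtype.ext key)
  have : B c = B d := congrArg Subtype.val hcd'
  exact hcd (B.injective this)

#harness_tags not_shellCloseTo_fcc_and_hcp

end Literature.Geometry.DiscreteGeometry
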